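import Summits.MatrixMultiplication.MatrixMultiplication.Theorems.SoloInformedFamilyStrata
import Summits.MatrixMultiplication.MatrixMultiplication.Theorems.SoloInformedSymmetricStratum
import Literature.Computability.AlgebraicComplexity.BorderRankCWDischarge

/-!
# The strata theorem for Coppersmith–Winograd-shaped carriers, unconditional

Solo deliverable (informed mode), the last word on the carrier family `T_{P,Q,M}`
(`SoloInformedCarrierFamily` … `SoloInformedSymmetricStratum`): the named fact
`CGLV2022_borderRank_cwTensor` used by `rank_symmBlock_eq_four` (and by generation 1's
`tensorRank_cwTensor_two_eq_four`) is PROVED in the tree (`CGLV2022_borderRank_cwTensor_holds`,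
`BorderRankCWDischarge`), so:

* `tensorRank_cwTensor_two`: `R(T_{cw,2}) = 4` with no hypothesis;
* `blockNormal_strata`: for `det M′ ≠ 0`, `M′` symmetric `⇒ R̲ = R = 4`, non-symmetric
  `⇒ R̲ = R = 5` — exhaustive, unconditional; `tensorRank_eq_four_iff_symm`: rank detects the
  Coppersmith–Winograd stratum; `algBorderRank_eq_tensorRank_blockNormal`: `R̲ = R` on the family;
* `rank_cwShape_dichotomy`: for general non-degenerate `(P, Q, M)`, `R̲(T_{P,Q,M}) = R(T_{P,Q,M})
  ∈ {4, 5}` (`cwShape_equiv_normBlock`: a member and its block-normal form restrict to each other),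
  and `asymptoticRank_cwShape_eq_normBlock`: the door values of the family are those of the
  block-normal carriers.
-/

noncomputable section

open scoped BigOperators
open Literature.Computability.AlgebraicComplexity

namespace Summit.MatrixMultiplication.MatrixMultiplication.Theorems.CarrierFamily

/-! ## The strata theorem, unconditional -/

/-- **`R(T_{cw,2}) = 4`, unconditionally**: the generation-1 theorem
`tensorRank_cwTensor_two_eq_four` with its hypothesis `CGLV2022_borderRank_cwTensor` discharged by
the tree's proof `CGLV2022_borderRank_cwTensor_holds`.
[cite: ConnerGesmundoLandsbergVentura2022, §1.2] -/
theorem tensorRank_cwTensor_two : tensorRank (cwTensor ℂ 2) = 4 :=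
  tensorRank_cwTensor_two_eq_four CGLV2022_borderRank_cwTensor_holds

/-- **Symmetric stratum: `R̲ = R = 4`, unconditionally.**
[cite: ConnerGesmundoLandsbergVentura2022, §1.2] -/
theorem rank_symmBlock {M : Matrix (Fin 3) (Fin 3) ℂ} (hdet : (innerBlock M).det ≠ 0)
    (hsym : M 1 2 = M 2 1) :
    algBorderRank (cwShapeTensor 1 1 M) = 4 ∧ tensorRank (cwShapeTensor 1 1 M) = 4 :=
  rank_symmBlock_eq_four CGLV2022_borderRank_cwTensor_holds hdet hsym

/-- **THE STRATA THEOREM** (unconditional, exhaustive over `det M′ ≠ 0`): the block-normal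
Coppersmith–Winograd-shaped carriers have exactly two rank strata, `M′` symmetric `⇒ R̲ = R = 4`
(the class of `T_{cw,2}`), `M′` non-symmetric `⇒ R̲ = R = 5` (`H(μ)`, `Γ₂`); in particular
`R̲ = R` throughout the family, and every member carries the same door `R̃ = 3 ⇒ ω = 2`.
[cite: ConnerGesmundoLandsbergVentura2022, §1.2, §4.1] [cite: CoppersmithWinograd1990, §6] -/
theorem blockNormal_strata {M : Matrix (Fin 3) (Fin 3) ℂ} (hdet : (innerBlock M).det ≠ 0) :
    (M 1 2 = M 2 1 →
        algBorderRank (cwShapeTensor 1 1 M) = 4 ∧ tensorRank (cwShapeTensor 1 1 M) = 4) ∧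
      (M 1 2 ≠ M 2 1 →
        algBorderRank (cwShapeTensor 1 1 M) = 5 ∧ tensorRank (cwShapeTensor 1 1 M) = 5) :=
  ⟨fun hsym => rank_symmBlock hdet hsym, fun hsym =>
    ⟨algBorderRank_blockNormal_eq_five hdet hsym, tensorRank_blockNormal_eq_five hdet hsym⟩⟩

/-- `R̲(T_{1,1,M}) = R(T_{1,1,M})` for every non-degenerate block. [folklore] -/
theorem algBorderRank_eq_tensorRank_blockNormal {M : Matrix (Fin 3) (Fin 3) ℂ}
    (hdet : (innerBlock M).det ≠ 0) :
    algBorderRank (cwShapeTensor 1 1 M) = tensorRank (cwShapeTensor 1 1 M) := by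
  by_cases hsym : M 1 2 = M 2 1
  · obtain ⟨h1, h2⟩ := (blockNormal_strata hdet).1 hsym
    rw [h1, h2]
  · obtain ⟨h1, h2⟩ := (blockNormal_strata hdet).2 hsym
    rw [h1, h2]

/-- **Rank detects the Coppersmith–Winograd stratum**: `R(T_{1,1,M}) = 4 ↔ M′ symmetric`
(`↔ T_{1,1,M}` restriction-equivalent to `T_{cw,2}`, `symmBlock_equiv_cwTensor_two`). [folklore] -/
theorem tensorRank_eq_four_iff_symm {M : Matrix (Fin 3) (Fin 3) ℂ}
    (hdet : (innerBlock M).det ≠ 0) : tensorRank (cwShapeTensor 1 1 M) = 4 ↔ M 1 2 = M 2 1 := by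
  refine ⟨fun h => ?_, fun hsym => ((blockNormal_strata hdet).1 hsym).2⟩
  by_contra hsym
  have h5 := ((blockNormal_strata hdet).2 hsym).2
  omega

/-! ## General blocks `(P, Q, M)`: the same two values -/

/-- `T_{P,Q,M}` and its block-normal form `T_{1,1,N}` restrict to each other.
[cite: BurgisserClausenShokrollahi1997, (14.24)] -/
theorem cwShape_equiv_normBlock (P Q M : Matrix (Fin 3) (Fin 3) ℂ) {e f : ℂ}
    (he : e * (P 1 1 * P 2 2 - P 1 2 * P 2 1) = 1) (hf : f * (Q 1 1 * Q 2 2 - Q 1 2 * Q 2 1) = 1) :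
    TensorRestrictsTo (cwShapeTensor P Q M) (cwShapeTensor 1 1 (normBlock P Q M e f)) ∧
      TensorRestrictsTo (cwShapeTensor 1 1 (normBlock P Q M e f)) (cwShapeTensor P Q M) := by
  refine ⟨cwShapeTensor_restrictsTo_normBlock P Q M he hf, ?_⟩
  obtain ⟨e11, e12, e21, e22⟩ := denormBlock_normBlock P Q M he hf
  have hres := cwShapeTensor_restrictsTo_denormBlock P Q (normBlock P Q M e f)
  have hcongr :
      cwShapeTensor P Q (denormBlock P Q (normBlock P Q M e f)) = cwShapeTensor P Q M := by
    funext i j k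
    fin_cases i <;> fin_cases j <;> fin_cases k <;> simp [cwShapeTensor, e11, e12, e21, e22]
  rwa [hcongr] at hres

/-- **For every member of the family `R̲(T_{P,Q,M}) = R(T_{P,Q,M}) ∈ {4, 5}`** (non-degenerate
blocks), the value `4` exactly on the Coppersmith–Winograd stratum (block-normal form symmetric).
[cite: ConnerGesmundoLandsbergVentura2022, §1.2, §4.1] -/
theorem rank_cwShape_dichotomy {P Q M : Matrix (Fin 3) (Fin 3) ℂ}
    (hP : (innerBlock P).det ≠ 0) (hQ : (innerBlock Q).det ≠ 0) (hM : (innerBlock M).det ≠ 0) :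
    algBorderRank (cwShapeTensor P Q M) = tensorRank (cwShapeTensor P Q M) ∧
      (tensorRank (cwShapeTensor P Q M) = 4 ∨ tensorRank (cwShapeTensor P Q M) = 5) := by
  set e : ℂ := ((innerBlock P).det)⁻¹ with he_def
  set f : ℂ := ((innerBlock Q).det)⁻¹ with hf_def
  have he : e * (innerBlock P).det = 1 := inv_mul_cancel₀ hP
  have hf : f * (innerBlock Q).det = 1 := inv_mul_cancel₀ hQ
  have he' : e * (P 1 1 * P 2 2 - P 1 2 * P 2 1) = 1 := by rwa [det_innerBlock] at he
  have hf' : f * (Q 1 1 * Q 2 2 - Q 1 2 * Q 2 1) = 1 := by rwa [det_innerBlock] at hf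
  have hN : (innerBlock (normBlock P Q M e f)).det ≠ 0 := by
    rw [det_innerBlock_normBlock, he, hf, one_mul, one_mul]
    refine mul_ne_zero (mul_ne_zero ?_ ?_) hM
    · exact inv_ne_zero hP
    · exact inv_ne_zero hQ
  obtain ⟨hto, hfrom⟩ := cwShape_equiv_normBlock P Q M he' hf'
  have hR : tensorRank (cwShapeTensor P Q M) =
      tensorRank (cwShapeTensor 1 1 (normBlock P Q M e f)) :=
    le_antisymm hfrom.tensorRank_le hto.tensorRank_le
  have hB : algBorderRank (cwShapeTensor P Q M) =
      algBorderRank (cwShapeTensor 1 1 (normBlock P Q M e f)) :=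
    le_antisymm hfrom.algBorderRank_le hto.algBorderRank_le
  rw [hR, hB, algBorderRank_eq_tensorRank_blockNormal hN]
  refine ⟨rfl, ?_⟩
  by_cases hsym : normBlock P Q M e f 1 2 = normBlock P Q M e f 2 1
  · exact Or.inl ((blockNormal_strata hN).1 hsym).2
  · exact Or.inr ((blockNormal_strata hN).2 hsym).2

/-- And the asymptotic rank of every member equals that of its block-normal form, so the family
of DOOR VALUES `{R̃(T_{P,Q,M})}` is `{R̃(T_{1,1,N}) : det N′ ≠ 0}` — `R̃(T_{cw,2})` on the symmetric
stratum (`asymptoticRank_symmBlock_eq`) and the values of the rank-`5` carriers off it.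
[cite: BurgisserClausenShokrollahi1997, Lemma (15.27)] -/
theorem asymptoticRank_cwShape_eq_normBlock (P Q M : Matrix (Fin 3) (Fin 3) ℂ) {e f : ℂ}
    (he : e * (P 1 1 * P 2 2 - P 1 2 * P 2 1) = 1) (hf : f * (Q 1 1 * Q 2 2 - Q 1 2 * Q 2 1) = 1) :
    asymptoticRank (cwShapeTensor P Q M) =
      asymptoticRank (cwShapeTensor 1 1 (normBlock P Q M e f)) := by
  obtain ⟨hto, hfrom⟩ := cwShape_equiv_normBlock P Q M he hf
  exact le_antisymm (asymptoticRank_le_of_algDegeneratesTo hfrom.algDegeneratesTo)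
    (asymptoticRank_le_of_algDegeneratesTo hto.algDegeneratesTo)

end Summit.MatrixMultiplication.MatrixMultiplication.Theorems.CarrierFamily

end
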